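import Mathlib
import HarnessLib

/-!
# K3 VL child `KLRegimeVolumeLimitV17F2` (stmt-HubbardSuperconductivity-20440), #23 «W2-HALF-VL», brick «W2H-OVL» part 18 (THRESHOLDS): the thirteen
# depth / rate / time conditions of `charSumWt_thinPairDiff_le_twoScale` from `Y ≤ x`, `π³ρ³Q ≤ 1`, `3π²ρ₃²Q ≤ 2` and ONE time-rate inequality

Cell `gate-hubbard-kl`, seat p3 (g15), lead of #23.  The per-piece lemma asks, at depth `x`, for `π³ρ³(r₃ⱼ⁽¹⁾ + r₃ⱼ⁽²⁾) ≤ 2x^{3−j}` (`j ≤ 3`, iso families A + C and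
tangent families B + D), `3π²ρ₃²(r₂ⱼ⁽ᴮ⁾ + r₂ⱼ⁽ᴰ⁾) ≤ 4x^{2−j}` (`j ≤ 2`) and the time conditions `θ₃ ≤ (4/(s₀·2M))³`.  With the uniform sizes
`r_{kℓ} ≤ Q·Y^{k−ℓ}` of part 17 (`thinPair_rates_uniform`) these follow from `1 ≤ Y ≤ x`, `π³ρ³Q ≤ 1`, `3π²ρ₃²Q ≤ 2`; the time coefficient obeys
`θ₃ ≤ Θ·(|2π/β|·Y₁)³` (`1/lam, 1/lam′ ≤ Y₁`, `Θ = Θ(e₀, d)` explicit) so that `Θ_c·|2π/β|·Y₁ ≤ 4/(s₀·2M)` with `Θ_c = max 1 Θ` suffices.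

* `thinPair_space_thresholds` — the eleven space conditions;
* `thinPair_timeCoeff_le`, `thinPair_time_threshold` — the time coefficient and the time condition.

Pure real-arithmetic bookkeeping; no definitions, no sorry. [folklore]
-/

noncomputable section

namespace Summit.HubbardSuperconductivity.HubbardSuperconductivity.Theorems.TorusFourierL2

set_option linter.dupNamespace false -- summit = problem name (single-conjunct summit), D-0017

open Real

/-- **The eleven space thresholds from the uniform rate sizes**: if the third-order coefficients of two families are `≤ Q·Y^{3−j}` and the second-order
ones `≤ Q·Y^{2−j}`, `1 ≤ Y ≤ x`, `π³ρ³Q ≤ 1` and `3π²ρ₃²Q ≤ 2`, then `π³ρ³(r₃ⱼ + r₃ⱼ′) ≤ 2x^{3−j}` and `3π²ρ₃²(w₂ⱼ + w₂ⱼ′) ≤ 4x^{2−j}`. [folklore] -/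
theorem thinPair_space_thresholds {Q Y x ρ ρ₃ a₀ a₁ a₂ a₃ c₀ c₁ c₂ c₃ u₀ u₁ u₂ v₀ v₁ v₂ : ℝ} (hQ : 0 ≤ Q) (hY1 : 1 ≤ Y) (hYx : Y ≤ x)
    (hρ : 0 ≤ ρ) (hρQ : π ^ 3 * ρ ^ 3 * Q ≤ 1) (hρ₃Q : 3 * π ^ 2 * ρ₃ ^ 2 * Q ≤ 2)
    (ha₀ : a₀ ≤ Q * Y ^ 3) (ha₁ : a₁ ≤ Q * Y ^ 2) (ha₂ : a₂ ≤ Q * Y) (ha₃ : a₃ ≤ Q)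
    (hc₀ : c₀ ≤ Q * Y ^ 3) (hc₁ : c₁ ≤ Q * Y ^ 2) (hc₂ : c₂ ≤ Q * Y) (hc₃ : c₃ ≤ Q)
    (hu₀ : u₀ ≤ Q * Y ^ 2) (hu₁ : u₁ ≤ Q * Y) (hu₂ : u₂ ≤ Q) (hv₀ : v₀ ≤ Q * Y ^ 2) (hv₁ : v₁ ≤ Q * Y) (hv₂ : v₂ ≤ Q) :
    (π ^ 3 * ρ ^ 3 * (a₀ + c₀) ≤ 2 * x ^ 3 ∧ π ^ 3 * ρ ^ 3 * (a₁ + c₁) ≤ 2 * x ^ 2 ∧ π ^ 3 * ρ ^ 3 * (a₂ + c₂) ≤ 2 * x ∧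
      π ^ 3 * ρ ^ 3 * (a₃ + c₃) ≤ 2) ∧
    (3 * π ^ 2 * ρ₃ ^ 2 * (u₀ + v₀) ≤ 4 * x ^ 2 ∧ 3 * π ^ 2 * ρ₃ ^ 2 * (u₁ + v₁) ≤ 4 * x ∧ 3 * π ^ 2 * ρ₃ ^ 2 * (u₂ + v₂) ≤ 4) := by
  have hπ := Real.pi_pos
  have hY0 : 0 ≤ Y := zero_le_one.trans hY1
  have hx1 : 1 ≤ x := hY1.trans hYx
  have hx0 : 0 ≤ x := zero_le_one.trans hx1
  have hYx2 : Y ^ 2 ≤ x ^ 2 := pow_le_pow_left₀ hY0 hYx 2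
  have hYx3 : Y ^ 3 ≤ x ^ 3 := pow_le_pow_left₀ hY0 hYx 3
  have hP : 0 ≤ π ^ 3 * ρ ^ 3 := by positivity
  have hP₃ : 0 ≤ 3 * π ^ 2 * ρ₃ ^ 2 := by positivity
  -- generic closing steps
  have c3 : ∀ {s e : ℝ}, s ≤ 2 * Q * e → 0 ≤ e → π ^ 3 * ρ ^ 3 * s ≤ 2 * e := by
    intro s e hs he
    calc π ^ 3 * ρ ^ 3 * s ≤ π ^ 3 * ρ ^ 3 * (2 * Q * e) := mul_le_mul_of_nonneg_left hs hP
      _ = 2 * (π ^ 3 * ρ ^ 3 * Q) * e := by ring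
      _ ≤ 2 * 1 * e := mul_le_mul_of_nonneg_right (mul_le_mul_of_nonneg_left hρQ (by norm_num)) he
      _ = 2 * e := by ring
  have c2 : ∀ {s e : ℝ}, s ≤ 2 * Q * e → 0 ≤ e → 3 * π ^ 2 * ρ₃ ^ 2 * s ≤ 4 * e := by
    intro s e hs he
    calc 3 * π ^ 2 * ρ₃ ^ 2 * s ≤ 3 * π ^ 2 * ρ₃ ^ 2 * (2 * Q * e) := mul_le_mul_of_nonneg_left hs hP₃
      _ = 2 * (3 * π ^ 2 * ρ₃ ^ 2 * Q) * e := by ring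
      _ ≤ 2 * 2 * e := mul_le_mul_of_nonneg_right (mul_le_mul_of_nonneg_left hρ₃Q (by norm_num)) he
      _ = 4 * e := by ring
  refine ⟨⟨c3 (by nlinarith only [ha₀, hc₀, hYx3, hQ]) (by positivity), c3 (by nlinarith only [ha₁, hc₁, hYx2, hQ]) (by positivity),
    ?_, ?_⟩, ⟨c2 (by nlinarith only [hu₀, hv₀, hYx2, hQ]) (by positivity), ?_, ?_⟩⟩
  · simpa using c3 (e := x) (by nlinarith only [ha₂, hc₂, hYx, hQ]) hx0
  · simpa using c3 (e := 1) (by linarith only [ha₃, hc₃]) zero_le_one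
  · simpa using c2 (e := x) (by nlinarith only [hu₁, hv₁, hYx, hQ]) hx0
  · simpa using c2 (e := 1) (by linarith only [hu₂, hv₂]) zero_le_one

/-- **The time coefficient of the per-piece lemma is `≤ Θ·(h·Y₁)³`** (`h = |2π/β|`, `1/lam ≤ Y₁`, `1/lam′ ≤ Y₁`, `κ = e₀²/lam²`, `0 ≤ d`), with
`Θ = 8e₀⁶ + 12e₀⁴ + 6(2e₀⁴ + e₀²)(2de₀²) + 6e₀²(4de₀⁴ + 2de₀²) + (8de₀⁶ + 12de₀⁴)`. [folklore] -/
theorem thinPair_timeCoeff_le {e₀ d lam lam' Y₁ h κ qt₁ qt₂ qt₃ Dt₁ Dt₂ θ₁ θ₂ θ₃ : ℝ} (hd : 0 ≤ d) (hlam : 0 < lam) (hlam' : 0 < lam')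
    (hh : 0 ≤ h) (hY : 1 / lam ≤ Y₁) (hY' : 1 / lam' ≤ Y₁)
    (hκ : κ = e₀ ^ 2 / lam ^ 2) (hqt₁ : qt₁ = 2 * (d * e₀ ^ 2) * h / lam') (hqt₂ : qt₂ = (4 * (d * e₀ ^ 4) + 2 * (d * e₀ ^ 2)) * h ^ 2 / lam' ^ 2)
    (hqt₃ : qt₃ = (8 * (d * e₀ ^ 6) + 12 * (d * e₀ ^ 4)) * h ^ 3 / lam' ^ 3) (hDt₁ : Dt₁ = 2 * lam * h) (hDt₂ : Dt₂ = 2 * h ^ 2)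
    (hθ₁ : θ₁ = κ * Dt₁ + qt₁) (hθ₂ : θ₂ = κ ^ 2 * Dt₁ ^ 2 + κ * Dt₂ + 2 * (κ * Dt₁) * qt₁ + qt₂)
    (hθ₃ : θ₃ = κ ^ 3 * Dt₁ ^ 3 + 3 * (κ ^ 2 * (Dt₁ * Dt₂)) + 3 * ((κ ^ 2 * Dt₁ ^ 2 + κ * Dt₂) * qt₁) + 3 * (κ * Dt₁ * qt₂) + qt₃) :
    0 ≤ θ₁ ∧ 0 ≤ θ₂ ∧ θ₃ ≤ (8 * e₀ ^ 6 + 12 * e₀ ^ 4 + 6 * (2 * e₀ ^ 4 + e₀ ^ 2) * (2 * (d * e₀ ^ 2)) + 6 * e₀ ^ 2 * (4 * (d * e₀ ^ 4) + 2 * (d * e₀ ^ 2)) +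
      (8 * (d * e₀ ^ 6) + 12 * (d * e₀ ^ 4))) * (h * Y₁) ^ 3 := by
  have hY0 : 0 ≤ Y₁ := le_trans (by positivity) hY
  have hhY : 0 ≤ h * Y₁ := mul_nonneg hh hY0
  -- atoms
  have a1 : κ * Dt₁ = 2 * e₀ ^ 2 * h * (1 / lam) := by rw [hκ, hDt₁]; field_simp
  have a1b : κ * Dt₁ ≤ 2 * e₀ ^ 2 * (h * Y₁) := by
    rw [a1]
    calc 2 * e₀ ^ 2 * h * (1 / lam) ≤ 2 * e₀ ^ 2 * h * Y₁ := mul_le_mul_of_nonneg_left hY (by positivity)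
      _ = _ := by ring
  have a10 : 0 ≤ κ * Dt₁ := by rw [a1]; positivity
  have a2 : κ * Dt₂ = 2 * e₀ ^ 2 * h ^ 2 * (1 / lam) ^ 2 := by rw [hκ, hDt₂]; field_simp
  have hY2 : (1 / lam) ^ 2 ≤ Y₁ ^ 2 := pow_le_pow_left₀ (by positivity) hY 2
  have hY2' : (1 / lam') ^ 2 ≤ Y₁ ^ 2 := pow_le_pow_left₀ (by positivity) hY' 2
  have hY3' : (1 / lam') ^ 3 ≤ Y₁ ^ 3 := pow_le_pow_left₀ (by positivity) hY' 3
  have a2b : κ * Dt₂ ≤ 2 * e₀ ^ 2 * (h * Y₁) ^ 2 := by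
    rw [a2, mul_pow, ← mul_assoc]; exact mul_le_mul_of_nonneg_left hY2 (by positivity)
  have a20 : 0 ≤ κ * Dt₂ := by rw [a2]; positivity
  have q1 : qt₁ = 2 * (d * e₀ ^ 2) * h * (1 / lam') := by rw [hqt₁]; field_simp
  have q1b : qt₁ ≤ 2 * (d * e₀ ^ 2) * (h * Y₁) := by
    rw [q1]
    calc 2 * (d * e₀ ^ 2) * h * (1 / lam') ≤ 2 * (d * e₀ ^ 2) * h * Y₁ := mul_le_mul_of_nonneg_left hY' (by positivity)
      _ = _ := by ring
  have q10 : 0 ≤ qt₁ := by rw [q1]; positivity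
  have q2 : qt₂ = (4 * (d * e₀ ^ 4) + 2 * (d * e₀ ^ 2)) * h ^ 2 * (1 / lam') ^ 2 := by rw [hqt₂]; field_simp
  have q2b : qt₂ ≤ (4 * (d * e₀ ^ 4) + 2 * (d * e₀ ^ 2)) * (h * Y₁) ^ 2 := by
    rw [q2]
    calc (4 * (d * e₀ ^ 4) + 2 * (d * e₀ ^ 2)) * h ^ 2 * (1 / lam') ^ 2 ≤ (4 * (d * e₀ ^ 4) + 2 * (d * e₀ ^ 2)) * h ^ 2 * Y₁ ^ 2 :=
          mul_le_mul_of_nonneg_left hY2' (by positivity)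
      _ = _ := by ring
  have q20 : 0 ≤ qt₂ := by rw [q2]; positivity
  have q3 : qt₃ = (8 * (d * e₀ ^ 6) + 12 * (d * e₀ ^ 4)) * h ^ 3 * (1 / lam') ^ 3 := by rw [hqt₃]; field_simp
  have q3b : qt₃ ≤ (8 * (d * e₀ ^ 6) + 12 * (d * e₀ ^ 4)) * (h * Y₁) ^ 3 := by
    rw [q3]
    calc (8 * (d * e₀ ^ 6) + 12 * (d * e₀ ^ 4)) * h ^ 3 * (1 / lam') ^ 3 ≤ (8 * (d * e₀ ^ 6) + 12 * (d * e₀ ^ 4)) * h ^ 3 * Y₁ ^ 3 :=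
          mul_le_mul_of_nonneg_left hY3' (by positivity)
      _ = _ := by ring
  refine ⟨by rw [hθ₁]; positivity, by rw [hθ₂]; positivity, ?_⟩
  rw [hθ₃]
  have t1 : κ ^ 3 * Dt₁ ^ 3 ≤ (2 * e₀ ^ 2) ^ 3 * (h * Y₁) ^ 3 := by
    rw [← mul_pow, ← mul_pow]; exact pow_le_pow_left₀ a10 a1b 3
  have t2 : κ ^ 2 * (Dt₁ * Dt₂) ≤ (2 * e₀ ^ 2) * (2 * e₀ ^ 2) * (h * Y₁) ^ 3 := by
    have e : κ ^ 2 * (Dt₁ * Dt₂) = (κ * Dt₁) * (κ * Dt₂) := by ring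
    rw [e]
    calc (κ * Dt₁) * (κ * Dt₂) ≤ (2 * e₀ ^ 2 * (h * Y₁)) * (2 * e₀ ^ 2 * (h * Y₁) ^ 2) := mul_le_mul a1b a2b a20 (by positivity)
      _ = _ := by ring
  have t3 : (κ ^ 2 * Dt₁ ^ 2 + κ * Dt₂) * qt₁ ≤ ((2 * e₀ ^ 2) ^ 2 + 2 * e₀ ^ 2) * (2 * (d * e₀ ^ 2)) * (h * Y₁) ^ 3 := by
    have u : κ ^ 2 * Dt₁ ^ 2 + κ * Dt₂ ≤ ((2 * e₀ ^ 2) ^ 2 + 2 * e₀ ^ 2) * (h * Y₁) ^ 2 := by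
      have : κ ^ 2 * Dt₁ ^ 2 ≤ (2 * e₀ ^ 2) ^ 2 * (h * Y₁) ^ 2 := by
        rw [← mul_pow, ← mul_pow]; exact pow_le_pow_left₀ a10 a1b 2
      nlinarith only [this, a2b]
    calc _ ≤ (((2 * e₀ ^ 2) ^ 2 + 2 * e₀ ^ 2) * (h * Y₁) ^ 2) * (2 * (d * e₀ ^ 2) * (h * Y₁)) := mul_le_mul u q1b q10 (by positivity)
      _ = _ := by ring
  have t4 : κ * Dt₁ * qt₂ ≤ (2 * e₀ ^ 2) * (4 * (d * e₀ ^ 4) + 2 * (d * e₀ ^ 2)) * (h * Y₁) ^ 3 := by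
    calc κ * Dt₁ * qt₂ ≤ (2 * e₀ ^ 2 * (h * Y₁)) * ((4 * (d * e₀ ^ 4) + 2 * (d * e₀ ^ 2)) * (h * Y₁) ^ 2) := mul_le_mul a1b q2b q20 (by positivity)
      _ = _ := by ring
  nlinarith only [t1, t2, t3, t4, q3b]

/-- **The time threshold**: if the time coefficient obeys `θ₃ ≤ Θ·(h·Y₁)³` with `Θ_c·h·Y₁ ≤ 4/(s₀·2M)` for some `Θ_c ≥ max 1 Θ`, then
`θ₃ ≤ (4/(s₀·2M))³`. [folklore] -/
theorem thinPair_time_threshold {M : ℕ} {θ₃ Θ Θc h Y₁ s₀ : ℝ} (hΘc1 : 1 ≤ Θc) (hΘc : Θ ≤ Θc) (hh : 0 ≤ h) (hY : 0 ≤ Y₁)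
    (hθ : θ₃ ≤ Θ * (h * Y₁) ^ 3) (hs : Θc * h * Y₁ ≤ 4 / (s₀ * (2 * M : ℕ))) :
    θ₃ ≤ (4 / (s₀ * (2 * M : ℕ))) ^ 3 := by
  have hΘc0 : 0 ≤ Θc := zero_le_one.trans hΘc1
  have h3 : Θ ≤ Θc ^ 3 := by
    calc Θ ≤ Θc := hΘc
      _ = Θc * 1 * 1 := by ring
      _ ≤ Θc * Θc * Θc := by gcongr
      _ = Θc ^ 3 := by ring
  have hhY : 0 ≤ h * Y₁ := mul_nonneg hh hY
  calc θ₃ ≤ Θ * (h * Y₁) ^ 3 := hθ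
    _ ≤ Θc ^ 3 * (h * Y₁) ^ 3 := mul_le_mul_of_nonneg_right h3 (by positivity)
    _ = (Θc * h * Y₁) ^ 3 := by ring
    _ ≤ (4 / (s₀ * (2 * M : ℕ))) ^ 3 := pow_le_pow_left₀ (by rw [mul_assoc]; exact mul_nonneg hΘc0 hhY) hs 3

/-- **The time coefficient, square slot separated**: as `thinPair_timeCoeff_le` but with the squared time step written `h₂` (`= h²`; in the per-piece lemma
`h = |2π/β|` while the square appears as `(2π/β)²`). [folklore] -/
theorem thinPair_timeCoeff_le' {e₀ d lam lam' Y₁ h h₂ κ qt₁ qt₂ qt₃ Dt₁ Dt₂ θ₁ θ₂ θ₃ : ℝ} (hd : 0 ≤ d) (hlam : 0 < lam) (hlam' : 0 < lam')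
    (hh : 0 ≤ h) (hh₂ : h₂ = h ^ 2) (hY : 1 / lam ≤ Y₁) (hY' : 1 / lam' ≤ Y₁)
    (hκ : κ = e₀ ^ 2 / lam ^ 2) (hqt₁ : qt₁ = 2 * (d * e₀ ^ 2) * h / lam') (hqt₂ : qt₂ = (4 * (d * e₀ ^ 4) + 2 * (d * e₀ ^ 2)) * h₂ / lam' ^ 2)
    (hqt₃ : qt₃ = (8 * (d * e₀ ^ 6) + 12 * (d * e₀ ^ 4)) * h ^ 3 / lam' ^ 3) (hDt₁ : Dt₁ = 2 * lam * h) (hDt₂ : Dt₂ = 2 * h₂)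
    (hθ₁ : θ₁ = κ * Dt₁ + qt₁) (hθ₂ : θ₂ = κ ^ 2 * Dt₁ ^ 2 + κ * Dt₂ + 2 * (κ * Dt₁) * qt₁ + qt₂)
    (hθ₃ : θ₃ = κ ^ 3 * Dt₁ ^ 3 + 3 * (κ ^ 2 * (Dt₁ * Dt₂)) + 3 * ((κ ^ 2 * Dt₁ ^ 2 + κ * Dt₂) * qt₁) + 3 * (κ * Dt₁ * qt₂) + qt₃) :
    0 ≤ θ₁ ∧ 0 ≤ θ₂ ∧ θ₃ ≤ (8 * e₀ ^ 6 + 12 * e₀ ^ 4 + 6 * (2 * e₀ ^ 4 + e₀ ^ 2) * (2 * (d * e₀ ^ 2)) + 6 * e₀ ^ 2 * (4 * (d * e₀ ^ 4) + 2 * (d * e₀ ^ 2)) +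
      (8 * (d * e₀ ^ 6) + 12 * (d * e₀ ^ 4))) * (h * Y₁) ^ 3 := by
  subst hh₂
  exact thinPair_timeCoeff_le hd hlam hlam' hh hY hY' hκ hqt₁ hqt₂ hqt₃ hDt₁ hDt₂ hθ₁ hθ₂ hθ₃

end Summit.HubbardSuperconductivity.HubbardSuperconductivity.Theorems.TorusFourierL2

end
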